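import Mathlib
import HarnessLib
import Summits.CriticalPhenomena.CardyFormulaZ2.Theses.CardyRotToConf
import Literature.Probability.RandomPlanarGeometry.SLEExistenceNeEightHolds
import Literature.Probability.RandomPlanarGeometry.ChordalReversibility

/-!
# Line `germ-label-transport` — crux stmt-CriticalPhenomena-0698 (`CardyRotToConfR2SymmetryUpgrade`)

NEGATIVE skeleton (crux-plan of idea `Ideas/germ-label-transport.md`, ideator 2, triage r1 3×pass).
The idea is a refutation lever: it builds ONE chordal family satisfying the typed bundle
`IsLocalMarkovChordalFamily` + non-tracing whose law in the unit disc is not chordal SLE₆, so the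
composition below concludes `¬ CardyRotToConfR2SymmetryUpgrade` (crux AS TYPED), not the crux.
The by-product for the routes is the repair (add `ChordalFamily.IsReversible`, ideator's `R2Reversible`).

The witness. Labels `ℓ : Option Circle`: `some u` = "stretch by 2 along the axis θ with
u = e^{2iθ}", `none` = "isotropic". Per-label families: `fam (some u) = stretchedSLE u`
(pull-back of chordal SLE₆ of the stretched domain `A_u D` along `A_u⁻¹`,
`A_u z = (3 z + u z̄)/2`), `fam none = sle6Family` (chordal SLE₆ itself — this replaces the card's
Haar mixture at label-free germs: any rotation-covariant admissible choice does, and SLE₆ keeps every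
label PURE, so the REVIEW/Cert "prior ≠ posterior" pinning objection to `P^mix` never arises).
The transported family is `P D := fam (Λ D.carrier (D.pt 0)) D` for a READER
`Λ : Set ℂ → ℂ → Option Circle` of the boundary germ of an open set at a boundary point.

Stubs (4; sorries only here):
* `stub_sle6Admissible`   (W₀, XL, known: LSW 2001 Thm 2.2/Cor 2.3–2.4, Schramm 2000 §1,
  Rohde–Schramm 2005, Alberts–Sheffield 2008) — chordal SLE₆ inhabits the typed bundle and traces
  no boundary arc. (= non-vacuity of the crux hypothesis; every positive line needs it too;
  Disproof §1: crux + non-vacuity ⇒ HasSLETrace 6.)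
* `stub_stretchTransport` (W₁, M) — the axioms other than similarity covariance transport through
  the real-linear homeomorphism `A_u`; similarity covariance of SLE₆ becomes the INTERTWINING
  `stretchedSLE (u·c/c̄) (c D + w) = (c · + w)_* stretchedSLE u D` (from `A_u ∘ S_{c,w} =
  S_{c,A_u w} ∘ A_{u c̄/c}`).
* `stub_reader`           (R+Sep, XL, the heart, where the line dies if it dies) — an equivariant,
  germ-local reader that labels the unit disc purely and is a.s. re-read correctly by its own process
  at every closed stopping set (readability (R); adversarial-boundary immunity (Sep) is inside the
  ∀ D).
* `stub_stretchedNotSLE6` (N, M/L) — the pull-back of SLE₆ of the ellipse `A_u 𝔻` is not SLE₆ of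
  `𝔻` (harmonic measure of the 2:1 ellipse from its centre is not uniform in the eccentric angle ⇒
  the boundary correspondence is not Möbius ⇒ some Cardy–Smirnov hitting probability differs;
  `sle_six_measureReal_hitsBefore`, `IsSLELaw.unique`).

Composition (no sorry, axioms propext/Classical.choice/Quot.sound):
`not_CardyRotToConfR2SymmetryUpgrade_of : W₀ → W₁ → (R+Sep) → N → ¬ crux`; contrapositive
`no_reader_of_crux` (what every POSITIVE line on the typed crux implicitly owes); `R2Reversible` /
`r2Reversible_of_crux` = the repair. MECHANICAL STATUS: `lean check` rc 0, 4 sorries (the stubs);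
`ledger skeleton check … --crux stmt-CriticalPhenomena-0698` = FAIL `skeleton.missing` BY DESIGN (the
audit wants a theorem concluding the crux by name; this line concludes its negation), so the stubs are
NOT registered on the crux — this file is refutation material for the cdisprove seat (`Disproof.lean`,
`Theorems/…/Negative/`) and repair material for the tenure planners of both routes.
Disproof.lean obligations honoured: `crux_false_without_isChordal/_targetClause` — the witness IS
chordal with the right target (W₀/W₁); `not_crux_of_two_families` template — our two families are
SLE₆ and `P`; `eq_of_isLocal_of_carrier_eq`-type blindness — labels are functions of (carrier, a)
only; `isTargetIndependent_arcFamily` irrelevant (non-tracing holds). Dead near-misses avoided: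
`P^mix` (E.lean) — no mixtures; `P^ccw` (g26-1) — non-tracing; J2 tangential junction (triage) and
comb bootstrap (F1) — no deterministic segments, the family is defined on all domains by one formula.
-/

noncomputable section

namespace Summit.CriticalPhenomena.CardyFormulaZ2.Cruxes.CardyRotToConfR2SymmetryUpgrade.GermLabelTransport

open MeasureTheory Set Filter Topology
open scoped ComplexConjugate NNReal ENNReal
open Literature.Probability
open Literature.Probability.RandomPlanarGeometry

/-! ## Objects -/

/-- The real-linear stretch by `2` along the axis `θ`, encoded by the unit complex number
`u = e^{2iθ}`: `A_u z = (3 z + u z̄) / 2` (for `u = 1`: `x + iy ↦ 2x + iy`). -/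
def stretchFun (u : ℂ) (z : ℂ) : ℂ := (3 * z + u * conj z) / 2

/-- The inverse of `stretchFun u` for `‖u‖ = 1`: `z ↦ (3 z - u z̄) / 4`. -/
def unstretchFun (u : ℂ) (z : ℂ) : ℂ := (3 * z - u * conj z) / 4

theorem continuous_stretchFun (u : ℂ) : Continuous (stretchFun u) := by
  unfold stretchFun; fun_prop

theorem continuous_unstretchFun (u : ℂ) : Continuous (unstretchFun u) := by
  unfold unstretchFun; fun_prop

theorem coe_mul_conj_coe (u : Circle) : (u : ℂ) * conj (u : ℂ) = 1 := by
  rw [Complex.mul_conj, Circle.normSq_coe, Complex.ofReal_one]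

theorem unstretchFun_stretchFun (u : Circle) (z : ℂ) : unstretchFun u (stretchFun u z) = z := by
  have hu := coe_mul_conj_coe u
  simp only [unstretchFun, stretchFun, map_div₀, map_add, map_mul, Complex.conj_conj,
    map_ofNat]
  linear_combination (-(z / 8)) * hu

theorem stretchFun_unstretchFun (u : Circle) (z : ℂ) : stretchFun u (unstretchFun u z) = z := by
  have hu := coe_mul_conj_coe u
  simp only [unstretchFun, stretchFun, map_div₀, map_sub, map_mul, Complex.conj_conj,
    map_ofNat]
  linear_combination (-(z / 8)) * hu

/-- The stretch `A_u` as a homeomorphism of the plane (`u : Circle`). -/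
def stretch (u : Circle) : ℂ ≃ₜ ℂ where
  toFun := stretchFun u
  invFun := unstretchFun u
  left_inv := unstretchFun_stretchFun u
  right_inv := stretchFun_unstretchFun u
  continuous_toFun := continuous_stretchFun u
  continuous_invFun := continuous_unstretchFun u

@[simp] theorem stretch_apply (u : Circle) (z : ℂ) : stretch u z = (3 * z + u * conj z) / 2 := rfl

/-- A chordal SLE₆ random curve in `D` (exists unconditionally in the tree:
`exists_isSLECurve_of_ne_eight`, Rohde–Schramm Thm 5.1 + Thm 7.1). -/
def sle6Curve (D : DobrushinDomain) : (ℝ≥0 → ℝ) → CurveClass ℂ :=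
  (exists_isSLECurve_of_ne_eight (κ := 6) (by norm_num) (by norm_num) D).choose

theorem isSLECurve_sle6Curve (D : DobrushinDomain) : IsSLECurve 6 D (sle6Curve D) :=
  (exists_isSLECurve_of_ne_eight (κ := 6) (by norm_num) (by norm_num) D).choose_spec

/-- THE chordal SLE₆ law of `(D; a, b)` (unique: `IsSLELaw.unique IsSLECurve.map_eq_holds`). -/
def sle6Law (D : DobrushinDomain) : Measure (CurveClass ℂ) :=
  Process.preWienerMeasure.map (sle6Curve D)

theorem isSLELaw_sle6Law (D : DobrushinDomain) : IsSLELaw 6 D (sle6Law D) :=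
  ⟨sle6Curve D, isSLECurve_sle6Curve D, rfl⟩

/-- The chordal SLE₆ family `D ↦ SLE₆(D; a, b)`. -/
def sle6Family : ChordalFamily := fun D => sle6Law D

/-- The `u`-stretched SLE₆ family: `(A_u⁻¹)_* SLE₆(A_u D; A_u a, A_u b)` — the scaling limit one
expects from critical percolation on a lattice squeezed along the axis of `u`; similarity covariant
only as a FAMILY indexed by `u` (rotations turn the axis). -/
def stretchedSLE (u : Circle) : ChordalFamily := fun D =>
  (sle6Law (D.map (stretch u))).map (CurveClass.map ((stretch u).symm : C(ℂ, ℂ)))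

/-- Per-label families: `none` = isotropic SLE₆, `some u` = `u`-stretched SLE₆. -/
def fam : Option Circle → ChordalFamily
  | none => sle6Family
  | some u => stretchedSLE u

/-- The action of the similarity `z ↦ c z + w` on labels: the axis `u = e^{2iθ}` turns by
`2 arg c`, i.e. `u ↦ u · c / c̄ = u / (c̄ / c)`; the isotropic label is fixed. -/
def act (c : ℂ) (hc : c ≠ 0) : Option Circle → Option Circle :=
  Option.map fun u => u / Circle.ofConjDivSelf c hc

/-- "`P D`-a.s. the curve traces no non-trivial sub-arc of `∂D`" — verbatim the non-tracing clause
of the crux. -/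
def NonTracing (P : ChordalFamily) : Prop :=
  ∀ D : DobrushinDomain, ∀ᵐ γ ∂(P D), ∀ c : Curve ℂ, CurveClass.mk c = γ →
    ∀ s t : unitInterval, s < t → c '' Set.Icc s t ⊆ frontier D.carrier →
      (c '' Set.Icc s t).Subsingleton

/-- The label a reader `Λ` assigns to a Dobrushin domain: read at the starting point `a = D.pt 0`. -/
def labelOf (Λ : Set ℂ → ℂ → Option Circle) (D : DobrushinDomain) : Option Circle :=
  Λ D.carrier (D.pt 0)

/-- The germ-label transport of the stretched SLE₆ families along the reader `Λ`. -/
def transport (Λ : Set ℂ → ℂ → Option Circle) : ChordalFamily := fun D => fam (labelOf Λ D) D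

/-! ## Stubs (the registered open lemmas of the line; `sorry` only here) -/

/-- **(W₀) SLE₆ is admissible.** The chordal SLE₆ family inhabits the typed bundle (chordal;
covariant under `z ↦ c z + w`; domain Markov through a Markov extension on explored configurations;
local in LSW's restriction form; target independent) and a.s. traces no boundary arc.
LSW 2001 Thm 2.2 / Cor 2.3–2.4, Schramm 2000 §1, Werner 2007 §3, Rohde–Schramm 2005,
Alberts–Sheffield 2008 (dim SLE₆ ∩ ℝ = 1/3 < 1). Size XL (known; = non-vacuity of the crux). -/
theorem stub_sle6Admissible : IsLocalMarkovChordalFamily sle6Family ∧ NonTracing sle6Family := by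
  sorry

/-- **(W₁) Affine transport.** Every typed axiom except similarity covariance transports from SLE₆
to the `u`-stretched family through the real-linear homeomorphism `A_u` (images of Jordan/marked
domains, `remainingDomain`, `stopAt`/`startFrom` and frontiers commute with plane homeomorphisms;
`CurveClass.stopAt_mk_holds`); similarity covariance of SLE₆ becomes the intertwining relation,
from `A_u (c z + w) = c · A_{u c̄/c} z + A_u w`. Size M. -/
theorem stub_stretchTransport (u : Circle) :
    (sle6Family.IsChordal → (stretchedSLE u).IsChordal) ∧
    (sle6Family.IsLocal → (stretchedSLE u).IsLocal) ∧
    (sle6Family.IsTargetIndependent → (stretchedSLE u).IsTargetIndependent) ∧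
    (sle6Family.IsDomainMarkov → (stretchedSLE u).IsDomainMarkov) ∧
    (NonTracing sle6Family → NonTracing (stretchedSLE u)) ∧
    (sle6Family.IsSimilarityCovariant →
      ∀ (D : DobrushinDomain) (c : ℂ) (hc : c ≠ 0) (w : ℂ),
        stretchedSLE (u / Circle.ofConjDivSelf c hc) (D.map (similarity c hc w)) =
          (stretchedSLE u D).map (CurveClass.map (similarity c hc w : C(ℂ, ℂ)))) := by
  sorry

/-- **(R + Sep) The reader.** There is a reader `Λ` of boundary germs — `Λ U z` looks only at the
germ of `∂U` at `z` — which is (L1) similarity-EQUIVARIANT, (L2) GERM-LOCAL at the starting point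
(equal on nested Dobrushin domains with the same marks that agree near `a`; when they do not agree,
`a ∈ closure (D ∖ D')` and locality is empty), (L4) labels the unit disc `(𝔻; 1, −1)` with a PURE
axis, and (L5) is a.s. RE-READ CORRECTLY by its own process: running `fam ℓ` in a domain labelled
`ℓ`, at every closed stopping set the remaining domain read at the tip gives back `ℓ` (interior tips:
two-sided frontier germ; boundary landings: the process-frontier half-germ wins against ANY half-arc
of `∂D` — zoom-ergodicity of the stretched-SLE₆ landing germ, `μ₀ ⊥ (A_u)_*μ₀`, Makarov/McMillan
structure of harmonic-measure-typical boundary points). Size XL; OPEN — the honest gap of the card. -/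
theorem stub_reader : ∃ Λ : Set ℂ → ℂ → Option Circle,
    (∀ (D : DobrushinDomain) (c : ℂ) (hc : c ≠ 0) (w : ℂ),
      labelOf Λ (D.map (similarity c hc w)) = act c hc (labelOf Λ D)) ∧
    (∀ D D' : DobrushinDomain, D'.carrier ⊆ D.carrier → D'.pt 0 = D.pt 0 → D'.pt 1 = D.pt 1 →
      labelOf Λ D' = labelOf Λ D ∨ D.pt 0 ∈ closure (D.carrier \ D'.carrier)) ∧
    (∃ u₀ : Circle, labelOf Λ DobrushinDomain.unitDisc = some u₀) ∧
    (∀ (ℓ : Option Circle) (D : DobrushinDomain), labelOf Λ D = ℓ →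
      ∀ F : Set ℂ, IsClosed F →
        ∀ᵐ γ ∂(fam ℓ D), Λ (remainingDomain D (γ.stopAt F)) (γ.stopAt F).target = ℓ) := by
  sorry

/-- **(N) Stretched SLE₆ is not SLE₆.** For every axis `u`, the pull-back along `A_u⁻¹` of chordal
SLE₆ of the ellipse-type domain `A_u 𝔻` is not a chordal SLE₆ law of `(𝔻; 1, −1)`: the 2:1
ellipse's harmonic measure from its centre is not uniform in the eccentric angle, so the boundary
correspondence `ψ⁻¹ ∘ A_u` (ψ the Riemann map with the same vertex images) is not Möbius, some
cross-ratio `(a, x, y, b)` moves, and by Cardy–Smirnov for SLE₆ (`sle_six_measureReal_hitsBefore`)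
+ `IsSLELaw.unique` a hitting probability differs. Size M/L. -/
theorem stub_stretchedNotSLE6 (u : Circle) :
    ¬ IsSLELaw 6 DobrushinDomain.unitDisc (stretchedSLE u DobrushinDomain.unitDisc) := by
  sorry

/-! ## Transport lemmas (proved) -/

theorem remainingDomain_const (D : DobrushinDomain) :
    remainingDomain D (CurveClass.mk (Curve.const (D.pt 0))) = D.carrier := by
  have ha : D.pt 0 ∉ D.carrier := by
    have h := D.pt_mem_frontier 0
    rw [D.isOpen.frontier_eq] at h
    exact h.2
  have hdiff : D.carrier \ (CurveClass.mk (Curve.const (D.pt 0))).range = D.carrier := by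
    rw [CurveClass.range_mk, Curve.range_const, sdiff_singleton_eq_self ha]
  ext z
  simp only [remainingDomain, hdiff, mem_setOf_eq]
  constructor
  · exact fun h => h.1
  · intro hz
    refine ⟨hz, ?_⟩
    rw [D.isConnected.isPreconnected.connectedComponentIn hz]
    exact frontier_subset_closure (D.pt_mem_frontier 1)

/-- A curve starting inside the closed set `C` is stopped at once. -/
theorem curve_stopAt_eq_const {C : Set ℂ} (γ : Curve ℂ) (h : γ.source ∈ C) :
    γ.stopAt C = Curve.const γ.source := by
  have h0 : γ.hitParam C = 0 :=
    le_antisymm (by simpa using Curve.hitParam_le (F := C) (γ := γ) (t := 0) h)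
      (γ.hitParam_mem_Icc C).1
  refine Curve.ext (ContinuousMap.ext fun s => ?_)
  change γ.stopAt C s = γ.source
  rw [Curve.stopAt_apply, h0, zero_mul, Set.projIcc_left]
  rfl

/-- A curve class starting inside `C` is stopped at once: its initial segment is the constant class. -/
theorem stopAt_eq_mk_const {C : Set ℂ} (γ : CurveClass ℂ) (h : γ.source ∈ C) :
    CurveClass.stopAt C γ = CurveClass.mk (Curve.const γ.source) := by
  have hs : γ.out.source = γ.source := by
    conv_rhs => rw [← CurveClass.mk_out γ]
    rfl
  change CurveClass.mk (γ.out.stopAt C) = _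
  rw [curve_stopAt_eq_const γ.out (hs ▸ h), hs]

/-- Two CHORDAL families have the same (trivial) stopped law when the starting point lies in the
stopping set — the empty case of LSW locality. -/
theorem stopped_eq_of_source_mem {P P' : ChordalFamily} (hP : P.IsChordal) (hP' : P'.IsChordal)
    (D : DobrushinDomain) {C : Set ℂ} (ha : D.pt 0 ∈ C) (T : Set (CurveClass ℂ)) :
    P D (CurveClass.stopAt C ⁻¹' T) = P' D (CurveClass.stopAt C ⁻¹' T) := by
  have key : ∀ {R : ChordalFamily}, R.IsChordal →
      R D (CurveClass.stopAt C ⁻¹' T) =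
        R D {_γ | CurveClass.mk (Curve.const (D.pt 0)) ∈ T} := by
    intro R hR
    refine measure_congr ?_
    filter_upwards [(hR D).2] with γ hγ
    have hsrc : γ.source ∈ C := hγ.1 ▸ ha
    simp only [eq_iff_iff]
    change CurveClass.stopAt C γ ∈ T ↔ CurveClass.mk (Curve.const (D.pt 0)) ∈ T
    rw [stopAt_eq_mk_const γ hsrc, hγ.1]
  haveI := (hP D).1
  haveI := (hP' D).1
  rw [key hP, key hP']
  by_cases hT : CurveClass.mk (Curve.const (D.pt 0)) ∈ T
  · simp [hT]
  · simp [hT]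

section Abstract

variable {L : Type*}

/-- A1: similarity covariance transports along an equivariant label. -/
theorem transport_isSimilarityCovariant (P : L → ChordalFamily)
    (α : ∀ c : ℂ, c ≠ 0 → L → L) (Θ : DobrushinDomain → L)
    (hΘ : ∀ (D : DobrushinDomain) (c : ℂ) (hc : c ≠ 0) (w : ℂ),
      Θ (D.map (similarity c hc w)) = α c hc (Θ D))
    (hP : ∀ (ℓ : L) (D : DobrushinDomain) (c : ℂ) (hc : c ≠ 0) (w : ℂ),
      P (α c hc ℓ) (D.map (similarity c hc w)) =
        (P ℓ D).map (CurveClass.map (similarity c hc w : C(ℂ, ℂ)))) :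
    ChordalFamily.IsSimilarityCovariant (fun D => P (Θ D) D) := by
  intro D c hc w
  simp only [hΘ, hP]

/-- A1': locality transports along a germ-local label (chordality covers the empty case). -/
theorem transport_isLocal (P : L → ChordalFamily) (Θ : DobrushinDomain → L)
    (hP : ∀ ℓ, (P ℓ).IsLocal) (hC : ∀ ℓ, (P ℓ).IsChordal)
    (hgerm : ∀ D D' : DobrushinDomain, D'.carrier ⊆ D.carrier → D'.pt 0 = D.pt 0 →
      D'.pt 1 = D.pt 1 → Θ D' = Θ D ∨ D.pt 0 ∈ closure (D.carrier \ D'.carrier)) :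
    ChordalFamily.IsLocal (fun D => P (Θ D) D) := by
  intro D D' hsub h0 h1 T hT
  rcases hgerm D D' hsub h0 h1 with h | h
  · simp only [h]
    exact hP (Θ D) D D' hsub h0 h1 T hT
  · change P (Θ D') D' _ = P (Θ D) D _
    rw [hP (Θ D') D D' hsub h0 h1 T hT]
    exact stopped_eq_of_source_mem (hC (Θ D')) (hC (Θ D)) D h T

/-- A1'': target independence transports along a label read at `(carrier, a)` only. -/
theorem transport_isTargetIndependent (P : L → ChordalFamily) (Θ : DobrushinDomain → L)
    (hP : ∀ ℓ, (P ℓ).IsTargetIndependent)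
    (hTI : ∀ D : MarkedDomain 3, Θ (D.chord 0 1 (by decide)) = Θ (D.chord 0 2 (by decide))) :
    ChordalFamily.IsTargetIndependent (fun D => P (Θ D) D) := by
  intro D T hT
  simp only [hTI]
  exact hP _ D T hT

/-- A2: the typed domain Markov property transports along a label that is a.s. re-read from the
remaining configuration. The transported extension is `Q (Λ U z) D past` — a function of the triple
because each `Q ℓ` is. -/
theorem transport_isDomainMarkov (P : L → ChordalFamily)
    (Q : L → DobrushinDomain → CurveClass ℂ → Measure (CurveClass ℂ))
    (hQ : ∀ ℓ, (P ℓ).IsMarkovExtension (Q ℓ))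
    (Λ : Set ℂ → ℂ → L) (Θ : DobrushinDomain → L) (hΘ : ∀ D, Θ D = Λ D.carrier (D.pt 0))
    (hread : ∀ (D : DobrushinDomain) (F : Set ℂ), IsClosed F →
      ∀ᵐ γ ∂(P (Θ D) D), Λ (remainingDomain D (γ.stopAt F)) (γ.stopAt F).target = Θ D) :
    ChordalFamily.IsDomainMarkov (fun D => P (Θ D) D) := by
  refine ⟨fun D p => Q (Λ (remainingDomain D p) p.target) D p, ?_, ?_, ?_⟩
  · intro D
    have h0 := (hQ (Θ D)).initial D
    have ht : (CurveClass.mk (Curve.const (D.pt 0))).target = D.pt 0 := rfl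
    simp only [remainingDomain_const, ht, ← hΘ]
    exact h0
  · intro D F hF S T hS hT
    rw [(hQ (Θ D)).markov D F hF S T hS hT]
    refine lintegral_congr_ae (ae_restrict_of_ae ?_)
    filter_upwards [hread D F hF] with γ hγ
    simp only [hγ]
  · intro D₁ D₂ p₁ p₂ hU ht hb
    simp only [hU, ht]
    exact (hQ _).domain D₁ D₂ p₁ p₂ hU ht hb

end Abstract

/-! ## Composition -/

/-- From the four stubs: the germ-label transport `transport Λ` is an admissible non-tracing chordal
family whose law in `(𝔻; 1, −1)` is a stretched SLE₆, hence not SLE₆ — the crux AS TYPED fails. -/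
theorem not_CardyRotToConfR2SymmetryUpgrade_of
    (hW : IsLocalMarkovChordalFamily sle6Family ∧ NonTracing sle6Family)
    (hT : ∀ u : Circle,
      (sle6Family.IsChordal → (stretchedSLE u).IsChordal) ∧
      (sle6Family.IsLocal → (stretchedSLE u).IsLocal) ∧
      (sle6Family.IsTargetIndependent → (stretchedSLE u).IsTargetIndependent) ∧
      (sle6Family.IsDomainMarkov → (stretchedSLE u).IsDomainMarkov) ∧
      (NonTracing sle6Family → NonTracing (stretchedSLE u)) ∧
      (sle6Family.IsSimilarityCovariant →
        ∀ (D : DobrushinDomain) (c : ℂ) (hc : c ≠ 0) (w : ℂ),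
          stretchedSLE (u / Circle.ofConjDivSelf c hc) (D.map (similarity c hc w)) =
            (stretchedSLE u D).map (CurveClass.map (similarity c hc w : C(ℂ, ℂ)))))
    (hR : ∃ Λ : Set ℂ → ℂ → Option Circle,
      (∀ (D : DobrushinDomain) (c : ℂ) (hc : c ≠ 0) (w : ℂ),
        labelOf Λ (D.map (similarity c hc w)) = act c hc (labelOf Λ D)) ∧
      (∀ D D' : DobrushinDomain, D'.carrier ⊆ D.carrier → D'.pt 0 = D.pt 0 → D'.pt 1 = D.pt 1 →
        labelOf Λ D' = labelOf Λ D ∨ D.pt 0 ∈ closure (D.carrier \ D'.carrier)) ∧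
      (∃ u₀ : Circle, labelOf Λ DobrushinDomain.unitDisc = some u₀) ∧
      (∀ (ℓ : Option Circle) (D : DobrushinDomain), labelOf Λ D = ℓ →
        ∀ F : Set ℂ, IsClosed F →
          ∀ᵐ γ ∂(fam ℓ D), Λ (remainingDomain D (γ.stopAt F)) (γ.stopAt F).target = ℓ))
    (hN : ∀ u : Circle,
      ¬ IsSLELaw 6 DobrushinDomain.unitDisc (stretchedSLE u DobrushinDomain.unitDisc)) :
    ¬ Summit.CriticalPhenomena.CardyFormulaZ2.Theses.CardyRotToConf.CardyRotToConfR2SymmetryUpgrade := by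
  intro hcrux
  obtain ⟨hW6, hnt6⟩ := hW
  obtain ⟨Λ, hequiv, hgerm, ⟨u₀, hu₀⟩, hread⟩ := hR
  -- per-label axioms
  have hCh : ∀ ℓ, (fam ℓ).IsChordal := fun ℓ => by
    cases ℓ with
    | none => exact hW6.isChordal
    | some u => exact (hT u).1 hW6.isChordal
  have hLoc : ∀ ℓ, (fam ℓ).IsLocal := fun ℓ => by
    cases ℓ with
    | none => exact hW6.isLocal
    | some u => exact (hT u).2.1 hW6.isLocal
  have hTI : ∀ ℓ, (fam ℓ).IsTargetIndependent := fun ℓ => by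
    cases ℓ with
    | none => exact hW6.targetIndependent
    | some u => exact (hT u).2.2.1 hW6.targetIndependent
  have hMk : ∀ ℓ, (fam ℓ).IsDomainMarkov := fun ℓ => by
    cases ℓ with
    | none => exact hW6.markov
    | some u => exact (hT u).2.2.2.1 hW6.markov
  have hNT : ∀ ℓ, NonTracing (fam ℓ) := fun ℓ => by
    cases ℓ with
    | none => exact hnt6
    | some u => exact (hT u).2.2.2.2.1 hnt6
  have hCov : ∀ (ℓ : Option Circle) (D : DobrushinDomain) (c : ℂ) (hc : c ≠ 0) (w : ℂ),
      fam (act c hc ℓ) (D.map (similarity c hc w)) =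
        (fam ℓ D).map (CurveClass.map (similarity c hc w : C(ℂ, ℂ))) := fun ℓ D c hc w => by
    cases ℓ with
    | none => exact hW6.similarity D c hc w
    | some u => exact (hT u).2.2.2.2.2 hW6.similarity D c hc w
  -- the transported family is admissible
  choose Q hQ using hMk
  have hadm : IsLocalMarkovChordalFamily (transport Λ) := by
    refine ⟨fun D => hCh _ D, ?_, ?_, ?_, ?_⟩
    · exact transport_isSimilarityCovariant fam act (labelOf Λ) hequiv hCov
    · exact transport_isDomainMarkov fam Q hQ Λ (labelOf Λ) (fun D => rfl)
        (fun D F hF => hread (labelOf Λ D) D rfl F hF)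
    · exact transport_isLocal fam (labelOf Λ) hLoc hCh hgerm
    · exact transport_isTargetIndependent fam (labelOf Λ) hTI (fun D => rfl)
  have hnt : NonTracing (transport Λ) := fun D => hNT _ D
  -- evaluate the crux at the transported family and the unit disc
  have hdisc := hcrux (transport Λ) hadm hnt DobrushinDomain.unitDisc
  have heq : transport Λ DobrushinDomain.unitDisc = stretchedSLE u₀ DobrushinDomain.unitDisc := by
    simp only [transport, hu₀, fam]
  rw [heq] at hdisc
  exact hN u₀ hdisc

/-- The line's conclusion from its registered stubs: the crux AS TYPED is false. -/
theorem not_CardyRotToConfR2SymmetryUpgrade :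
    ¬ Summit.CriticalPhenomena.CardyFormulaZ2.Theses.CardyRotToConf.CardyRotToConfR2SymmetryUpgrade :=
  not_CardyRotToConfR2SymmetryUpgrade_of stub_sle6Admissible stub_stretchTransport stub_reader
    stub_stretchedNotSLE6

/-- Contrapositive, for the POSITIVE lines on the typed crux: granted the three "known-type" stubs
(SLE₆ admissible, affine transport, stretched ≠ SLE₆), any proof of the crux as typed is a proof that
NO equivariant germ-local readable reader exists — i.e. it must somewhere exclude label smuggling
through boundary germs (the obligation this line adds to `Disproof.lean`'s `_false_without_` list). -/
theorem no_reader_of_crux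
    (hcrux : Summit.CriticalPhenomena.CardyFormulaZ2.Theses.CardyRotToConf.CardyRotToConfR2SymmetryUpgrade)
    (hW : IsLocalMarkovChordalFamily sle6Family ∧ NonTracing sle6Family)
    (hT : ∀ u : Circle,
      (sle6Family.IsChordal → (stretchedSLE u).IsChordal) ∧
      (sle6Family.IsLocal → (stretchedSLE u).IsLocal) ∧
      (sle6Family.IsTargetIndependent → (stretchedSLE u).IsTargetIndependent) ∧
      (sle6Family.IsDomainMarkov → (stretchedSLE u).IsDomainMarkov) ∧
      (NonTracing sle6Family → NonTracing (stretchedSLE u)) ∧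
      (sle6Family.IsSimilarityCovariant →
        ∀ (D : DobrushinDomain) (c : ℂ) (hc : c ≠ 0) (w : ℂ),
          stretchedSLE (u / Circle.ofConjDivSelf c hc) (D.map (similarity c hc w)) =
            (stretchedSLE u D).map (CurveClass.map (similarity c hc w : C(ℂ, ℂ)))))
    (hN : ∀ u : Circle,
      ¬ IsSLELaw 6 DobrushinDomain.unitDisc (stretchedSLE u DobrushinDomain.unitDisc)) :
    ¬ ∃ Λ : Set ℂ → ℂ → Option Circle,
      (∀ (D : DobrushinDomain) (c : ℂ) (hc : c ≠ 0) (w : ℂ),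
        labelOf Λ (D.map (similarity c hc w)) = act c hc (labelOf Λ D)) ∧
      (∀ D D' : DobrushinDomain, D'.carrier ⊆ D.carrier → D'.pt 0 = D.pt 0 → D'.pt 1 = D.pt 1 →
        labelOf Λ D' = labelOf Λ D ∨ D.pt 0 ∈ closure (D.carrier \ D'.carrier)) ∧
      (∃ u₀ : Circle, labelOf Λ DobrushinDomain.unitDisc = some u₀) ∧
      (∀ (ℓ : Option Circle) (D : DobrushinDomain), labelOf Λ D = ℓ →
        ∀ F : Set ℂ, IsClosed F →
          ∀ᵐ γ ∂(fam ℓ D), Λ (remainingDomain D (γ.stopAt F)) (γ.stopAt F).target = ℓ) :=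
  fun hR => not_CardyRotToConfR2SymmetryUpgrade_of hW hT hR hN hcrux

/-! ## The repair this line recommends (for the tenure planners of both routes; not a stub)

Reversibility kills every germ-label transport: a label read at `a` and a label read at `b` cannot
both drive one law (TI + locality force the label to be a function of the germ at the START point,
reversibility then forces it to be constant on co-occurring germ pairs, hence label-free), and it is
free for the ℤ² interface limits of `LimitFamily` / `LagHandOff` (the `a → b` interface is the
reversed `b → a` interface with colours swapped). The transported family `transport Λ` above is NOT
reversible: `(transport Λ) D.swap` reads the germ at `b`. -/

/-- R2 with `ChordalFamily.IsReversible` added to the hypotheses (ideator's `R2Reversible`). -/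
def R2Reversible : Prop :=
  ∀ P : ChordalFamily, IsLocalMarkovChordalFamily P → P.IsReversible → NonTracing P →
    ∀ D : DobrushinDomain, IsSLELaw 6 D (P D)

/-- The repaired statement is weaker than the crux as typed. -/
theorem r2Reversible_of_crux
    (h : Summit.CriticalPhenomena.CardyFormulaZ2.Theses.CardyRotToConf.CardyRotToConfR2SymmetryUpgrade) :
    R2Reversible :=
  fun P hP _ hnt D => h P hP hnt D

end Summit.CriticalPhenomena.CardyFormulaZ2.Cruxes.CardyRotToConfR2SymmetryUpgrade.GermLabelTransport
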